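import Summits.HodgeConjecture.HodgeConjecture.Theorems.Ring2AbelianAllAndreFibreClassAlgebraicFibre
import HarnessLib

/-!
# Ring 2 · sub-cell AbelianAll (ALL ABELIAN VARIETIES), André axis, part XV-e — RANK-ONE INVARIANTS: if the
# invariant part `j_{t₀}^* H²ᵖ(𝒳)` of a fibre is a LINE it is spanned by the hyperplane power `K_{t₀}ᵖ`, so
# (N_p)(t₀) holds outright; on the W₆ habitat (invariants `ℚθ`, `ℚθ²` in degrees 2, 4) the fibre-class Lefschetz
# node is therefore EXACTLY (N₃)(t₀) — "`θ³` and the Weil classes of one fibre lift to algebraic classes of `𝒳`"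

HONEST FRAMING (page 1, verbatim): **research route, not a corollary; conditional on HC_CM plus one named
minimal statement.** Cell line: research route conditional on HC_CM; not a corollary; Q11.4-sentence-2
already refuted in dim ≥ 3. Nothing in this file proves a case of the Hodge conjecture for an abelian variety.
`HC_CM` = `Theses.RankFourFaces.CMAbelianHodge` (a BINDER wherever it occurs), item `Theses.RankFourFaces.CMToAbelian`
(stmt-16267) OPEN and not closed here. Seat `pub-hodge-ring2-ab-andre-2`, gen 7 (with parts XV-a…d).

## What is proved (theorems only; no definition, no named fact, no sorry)

* `map_fiberι_lefschetzPowTo_one_ne_zero_of_le` — `j_t^*(Kᵖ) = K_tᵖ ≠ 0` for `p ≤ d` (`K` the algebraic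
  hyperplane-type class of part XIV-b with hard Lefschetz on every fibre; `K_tᵈ = L^{d-p} K_tᵖ ≠ 0`).
* **`algebraicInvariantClassesAt_of_finrank_range_eq_one`** — if `dim_ℂ j_{t₀}^* H²ᵖ(𝒳(ℂ); ℂ) = 1` (RANK-ONE
  INVARIANTS in degree `2p ≤ 2d`) then (N_p)(t₀): the line is `ℂ · K_{t₀}ᵖ` and `c · Kᵖ` is algebraic on `𝒳`.
  No Hodge theory, no `HC_CM`.
* **`fibreClassLefschetzOn_relDim_six_of_rankOne_of_algebraicInvariantClassesAt_three`** — for a compact pencil of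
  abelian SIXFOLDS with rank-one invariants in degrees 2 and 4 at `t₀`: **(N₃)(t₀) ⟹ (β′_f)** (part XIV-g), `HC_CM`-free.
* **`fibreClassLefschetzOn_iff_algebraicInvariantClassesAt_three_of_HC_CM`** — same pencil with a CM fibre `t₀` and
  Hodge invariants in degree 6: **`HC_CM ⊢ (β′_f) ⟺ (N₃)(t₀)`** (part XV-b for ⟹).
* `weilSixfolds_of_cmPowerWeilPencilsAt_of_rankOne_of_algebraicInvariantClassesAt_three` — the W₆ row of part XIV-g
  with its bracket reduced to "(N₃) at one fibre" on pencils with rank-one invariants in degrees 2, 4 (`HC_CM`-free).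

## Reading (RING2-MAP §AbelianAll (ab-andre-2, gen 7))

For a compact Weil-sixfold pencil with monodromy Zariski-dense in `SU(3,3)` the invariants are `I₂ = ℚθ`,
`I₄ = ℚθ²`, `I₆ = ℚθ³ ⊕ W_K` (AA2.45; a print statement about the habitat, typed here as the two `finrank = 1`
binders and the degree-6 Hodge-invariants binder). On such a pencil the whole fibre-class Lefschetz node (β′_f) —
seven clauses `p = 0,…,6`, an algebraic correspondence on the 14-fold `𝒳 × 𝒳` in each — is ONE statement:
(N₃)(t₀), "every class of `j_{t₀}^* H⁶(𝒳)` = `ℂθ³ ⊕ W_K ⊗ ℂ` is the restriction of an algebraic class of the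
7-fold `𝒳`", i.e. (as `θ³ = j^*K³` always lifts) **"the two Weil classes of ONE fibre are restrictions of algebraic
codimension-3 cycles on the total space"** — ⟸ unconditionally, ⟹ modulo `HC_CM` at a CM fibre. This is the
find-the-cycle problem of AA2.36/AA2.45 with every Lefschetz-type detour removed.

NOT CLAIMED: the rank-one / Hodge-invariants binders for any concrete pencil; (N₃); W₆.

References: Abdulali1994FamiliesAV (Conj. 5.3, Thm. 5.5 p. 1130); Andre1996Motifs (§6.3 Remarque 2 p. 33);
VoisinHodgeI2002 (§6.2.3 Thm. 6.25, §11.3.3 Lemma 11.41); VoisinHodgeII2003 (§9.2.4 Prop. 9.20).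
-/

noncomputable section

set_option linter.dupNamespace false

namespace Summit.HodgeConjecture.HodgeConjecture.Ring2.AbelianAll

open CategoryTheory AlgebraicGeometry MonoidalCategory CartesianMonoidalCategory
open Literature.AlgebraicGeometry Literature.AlgebraicGeometry.Motives
open Literature.AlgebraicGeometry.HodgeTheory
open Literature.AlgebraicTopology.SingularHomology (singularCohomology)
open Literature.AlgebraicGeometry.Deligne1982 (cmLocus)
open Literature.Geometry.Kaehler (HasHardLefschetzProperty)
open Summit.HodgeConjecture.HodgeConjecture.Theses

variable {𝒳 S : SchemeOver ℂ}

/-! ## §1 `K_tᵖ ≠ 0` for `p ≤ d`, and rank-one invariants are spanned by it -/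

/-- `j_t^*(L_Kᵖ 1) = K_tᵖ ≠ 0` in `H²ᵖ(𝒳_t(ℂ); ℂ)` for `p ≤ d`, for a global class `K` with hard Lefschetz on every
fibre (`K_tᵈ = L_{K_t}^{d-p} K_tᵖ` and `K_tᵈ ≠ 0`, part XIV-c). [cite: VoisinHodgeI2002, §6.2.3 Thm. 6.25]
[cite: HatcherAT2002, §3.1 p. 199] -/
theorem map_fiberι_lefschetzPowTo_one_ne_zero_of_le {d : ℕ} {f : 𝒳 ⟶ S} (hf : IsCompactAbelianPencil f d)
    {K : complexBetti 𝒳 2} (hKL : ∀ s : ComplexPoints S, HasHardLefschetzProperty (complexBetti.map (fiberι f s) 2 K) d)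
    {p : ℕ} (hp : p ≤ d) (h0 : 0 + 2 * p = 2 * p) (t : ComplexPoints S) :
    complexBetti.map (fiberι f t) (2 * p)
      (lefschetzPowTo K p 0 (2 * p) h0 (singularCohomology.one ℂ (ComplexPoints 𝒳))) ≠ 0 := by
  obtain ⟨r, rfl⟩ : ∃ r, d = p + r := ⟨d - p, by omega⟩
  intro h
  apply map_fiberι_lefschetzPowTo_one_ne_zero hf hKL (show 0 + 2 * (p + r) = 2 * (p + r) by omega) t
  rw [← lefschetzPowTo_lefschetzPowTo K r h0 (show 2 * p + 2 * r = 2 * (p + r) by omega)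
      (show 0 + 2 * (p + r) = 2 * (p + r) by omega),
    map_fiberι_lefschetzPowTo t K r (2 * p) (2 * (p + r)) (show 2 * p + 2 * r = 2 * (p + r) by omega), h, map_zero]

/-- **RANK-ONE INVARIANTS ⟹ (N_p)(t₀).** If the image `j_{t₀}^* H²ᵖ(𝒳(ℂ); ℂ) ⊆ H²ᵖ(𝒳_{t₀}(ℂ); ℂ)` is
one-dimensional (`p ≤ d`), it is the line `ℂ · K_{t₀}ᵖ` through the restriction of the ALGEBRAIC class `Kᵖ` (`K` a
hyperplane-type divisor class, part XIV-b `exists_algebraic_lefschetzClass`; `L_Kᵖ` preserves algebraic classes,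
Voisin II Prop. 9.20), so every `j_{t₀}^* W` is `j_{t₀}^*(c · Kᵖ)`: `AlgebraicInvariantClassesAt hf t₀ p`. In print
the hypothesis holds in every degree `2p ≠ d` for pencils with monodromy Zariski-dense in `Sp` or `SU(n,n)`
(invariant theory), e.g. degrees 2 and 4 on the Weil habitat (W_E)₃. No Hodge theory, no `HC_CM`.
[cite: VoisinHodgeII2003, §9.2.4 Prop. 9.20] [cite: VoisinHodgeI2002, §6.2.3 Thm. 6.25]
[cite: Andre1996Motifs, §6.3 Remarque 2 (p. 33)] -/
theorem algebraicInvariantClassesAt_of_finrank_range_eq_one {d : ℕ} {f : 𝒳 ⟶ S} (hf : IsCompactAbelianPencil f d)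
    (t₀ : ComplexPoints S) {p : ℕ} (hp : p ≤ d)
    (h1 : Module.finrank ℂ (LinearMap.range (complexBetti.map (fiberι f t₀) (2 * p)).hom) = 1) :
    AlgebraicInvariantClassesAt hf t₀ p := by
  have h𝒳 := hf.isSmoothProjective_total
  obtain ⟨K, hKalg, hKL⟩ := exists_algebraic_lefschetzClass hf
  have h0 : 0 + 2 * p = 2 * p := by omega
  set j : complexBetti 𝒳 (2 * p) →ₗ[ℂ] complexBetti (fiberOver f t₀) (2 * p) :=
    (complexBetti.map (fiberι f t₀) (2 * p)).hom with hj
  have hjapply : ∀ W, j W = complexBetti.map (fiberι f t₀) (2 * p) W := fun _ ↦ rfl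
  set Kp := lefschetzPowTo K p 0 (2 * p) h0 (singularCohomology.one ℂ (ComplexPoints 𝒳)) with hKp
  have hKpalg : Kp ∈ algebraicClasses 𝒳 p := lefschetzPowTo_one_mem_algebraicClasses_of_mem h𝒳 hKalg p h0
  have hv : j Kp ≠ 0 := by
    rw [hjapply]
    exact map_fiberι_lefschetzPowTo_one_ne_zero_of_le hf hKL hp h0 t₀
  have hvmem : j Kp ∈ LinearMap.range j := ⟨Kp, rfl⟩
  have hv' : (⟨j Kp, hvmem⟩ : LinearMap.range j) ≠ 0 := fun h ↦ hv (congrArg Subtype.val h)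
  intro W
  obtain ⟨c, hc⟩ := (finrank_eq_one_iff_of_nonzero' _ hv').1 h1 ⟨j W, W, rfl⟩
  refine ⟨c • Kp, Submodule.smul_mem _ c hKpalg, ?_⟩
  have hc' : c • j Kp = j W := by
    have h := congrArg Subtype.val hc
    rwa [Submodule.coe_smul] at h
  rw [← hjapply, ← hjapply, map_smul, hc']

/-- Rank-one invariants at `t₀` give (N_p) at EVERY fibre (part XIV-f's independence of the fibre).
[cite: Andre1996Motifs, §5.1 (p. 25)] -/
theorem algebraicInvariantClassesAt_of_finrank_range_eq_one_at {d : ℕ} {f : 𝒳 ⟶ S}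
    (hf : IsCompactAbelianPencil f d) (t₀ : ComplexPoints S) {p : ℕ} (hp : p ≤ d)
    (h1 : Module.finrank ℂ (LinearMap.range (complexBetti.map (fiberι f t₀) (2 * p)).hom) = 1)
    (t : ComplexPoints S) : AlgebraicInvariantClassesAt hf t p :=
  algebraicInvariantClassesAt_of_at hf (algebraicInvariantClassesAt_of_finrank_range_eq_one hf t₀ hp h1) t

/-! ## §2 The W₆ habitat: (β′_f) is exactly (N₃) at one fibre -/

/-- **Sixfold pencils with rank-one invariants in degrees 2 and 4: (N₃)(t₀) ⟹ (β′_f)**, `HC_CM`-free ((N₁), (N₂)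
from §1, then part XIV-g `fibreClassLefschetzOn_relDim_six_of_algebraicInvariants`).
[cite: Abdulali1994FamiliesAV, Conjecture 5.3 (p. 1130)] [cite: Andre1996Motifs, §6.3 Remarque 2 (p. 33)] -/
theorem fibreClassLefschetzOn_relDim_six_of_rankOne_of_algebraicInvariantClassesAt_three {f : 𝒳 ⟶ S}
    (hf : IsCompactAbelianPencil f 6) (t₀ : ComplexPoints S)
    (h2 : Module.finrank ℂ (LinearMap.range (complexBetti.map (fiberι f t₀) (2 * 1)).hom) = 1)
    (h4 : Module.finrank ℂ (LinearMap.range (complexBetti.map (fiberι f t₀) (2 * 2)).hom) = 1)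
    (h₃ : AlgebraicInvariantClassesAt hf t₀ 3) : FibreClassLefschetzOn hf :=
  fibreClassLefschetzOn_relDim_six_of_algebraicInvariants hf t₀
    (algebraicInvariantClassesAt_of_finrank_range_eq_one hf t₀ (by omega) h2)
    (algebraicInvariantClassesAt_of_finrank_range_eq_one hf t₀ (by omega) h4) h₃

/-- **`HC_CM ⊢ (β′_f) ⟺ (N₃)(t₀)` on a compact pencil of abelian sixfolds with a CM fibre `t₀`, rank-one invariants
in degrees 2 and 4 and Hodge invariants in degree 6** (⟹: part XV-b at the algebraic CM fibre; ⟸: previous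
theorem). On the Weil habitat (W_E)₃ this reads: the fibre-class Lefschetz node holds iff the Weil classes (and
`θ³`) of the CM fibre are restrictions of algebraic classes of the 7-fold `𝒳`. research route, not a corollary;
conditional on HC_CM plus one named minimal statement. [cite: Abdulali1994FamiliesAV, Theorem 5.5 (p. 1130)]
[cite: Andre1996Motifs, §6.3 Lemme 6.3.1 and Remarque 2 (pp. 31–33)] -/
theorem fibreClassLefschetzOn_iff_algebraicInvariantClassesAt_three_of_HC_CM (hCM : RankFourFaces.CMAbelianHodge)
    {f : 𝒳 ⟶ S} (hf : IsCompactAbelianPencil f 6) {t₀ : ComplexPoints S} (ht₀ : t₀ ∈ cmLocus f 6)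
    (h2 : Module.finrank ℂ (LinearMap.range (complexBetti.map (fiberι f t₀) (2 * 1)).hom) = 1)
    (h4 : Module.finrank ℂ (LinearMap.range (complexBetti.map (fiberι f t₀) (2 * 2)).hom) = 1)
    (hHodge : ∀ W : complexBetti 𝒳 (2 * 3), IsRationalClass W →
      IsOfHodgeType 6 (fiberOver f t₀) (2 * 3) 3 3 (complexBetti.map (fiberι f t₀) (2 * 3) W)) :
    FibreClassLefschetzOn hf ↔ AlgebraicInvariantClassesAt hf t₀ 3 :=
  ⟨fun hF ↦ algebraicInvariantClassesAt_of_fibreClassLefschetzOn_of_fibre hf hF t₀ 3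
      (map_fiberι_mem_algebraicClasses_of_hodgeType_of_HC_CM hCM hf ht₀ 3 hHodge),
    fibreClassLefschetzOn_relDim_six_of_rankOne_of_algebraicInvariantClassesAt_three hf t₀ h2 h4⟩

/-- **The W₆ row with the SMALLEST bracket this column can state**: `WeilSixfolds ⟸ (W_E)₃ ∧ [every CM-pointed
compact pencil of abelian sixfolds has a fibre with rank-one invariants in degrees 2, 4 and (N₃)]` — `HC_CM`-free
(part IX's row through §2). The rank-one clauses are print-true on the habitat (big monodromy); (N₃) is where the
Weil classes sit. research route, not a corollary; conditional on HC_CM plus one named minimal statement.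
[cite: Andre1996Motifs, §6.3 Lemme 6.3.1 and Remarque 2 (pp. 31–33)] [cite: Abdulali1994FamiliesAV, Conjecture 5.3 (p. 1130)] -/
theorem weilSixfolds_of_cmPowerWeilPencilsAt_of_rankOne_of_algebraicInvariantClassesAt_three
    (hW : CMPowerAnchoredCompactWeilPencilsAt 3)
    (hN : ∀ ⦃𝒳 S : SchemeOver ℂ⦄ ⦃f : 𝒳 ⟶ S⦄ (hf : IsCompactAbelianPencil f 6), (cmLocus f 6).Nonempty →
      ∃ t₀ : ComplexPoints S,
        Module.finrank ℂ (LinearMap.range (complexBetti.map (fiberι f t₀) (2 * 1)).hom) = 1 ∧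
        Module.finrank ℂ (LinearMap.range (complexBetti.map (fiberι f t₀) (2 * 2)).hom) = 1 ∧
        AlgebraicInvariantClassesAt hf t₀ 3) :
    Theses.SevenfoldWeilCensus.WeilSixfolds :=
  weilSixfolds_of_cmPowerWeilPencilsAt_of_algebraicInvariants hW fun _ _ _ hf hcm ↦ by
    obtain ⟨t₀, h2, h4, h₃⟩ := hN hf hcm
    exact ⟨t₀, algebraicInvariantClassesAt_of_finrank_range_eq_one hf t₀ (by omega) h2,
      algebraicInvariantClassesAt_of_finrank_range_eq_one hf t₀ (by omega) h4, h₃⟩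

end Summit.HodgeConjecture.HodgeConjecture.Ring2.AbelianAll

end
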